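import Literature.AlgebraicGeometry.Resolution.AbhyankarEtaleAscentProofs
import Literature.AlgebraicGeometry.Resolution.KnafKuhlmann2005Thm34HenselRoot
import Literature.AlgebraicGeometry.Resolution.AbhyankarRationalUniformization
import Literature.AlgebraicGeometry.Resolution.KnafKuhlmann2009Prop23
import Literature.AlgebraicGeometry.Resolution.ValuedFunctionFieldsLemmas
import Summits.ResolutionOfSingularities.ResolutionOfSingularities.Theorems.ValuativeLuAlphaPTorsorHenselRootChartHelpers
import HarnessLib

/-!
# `α_p`-torsors along Abhyankar places: the base chart from a Hensel root

Crux `Valuative.LuAlphaPTorsor` (item `stmt-ResolutionOfSingularities-0641`), line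
`pfaff-line-log-final-forms`, registered stub `stub_henselRootChart` (S2 of reshape v6).

Setting: `k` a field of characteristic `p`, `K ⊇ k` a finitely generated field extension, `O ⊇ k`
a valuation ring of `K` which is ZERO-DIMENSIONAL (every residue is algebraic over `k`), `M` an
intermediate field of `K/k`, finitely generated over `k`, over which `K` is algebraic, and along
which `O` is an Abhyankar place with separably generated residue field extension.

**Claim.** There is a "very good chart" of `M`: a finitely generated `k`-subalgebra
`R ⊆ O ∩ M` with `M ⊆ Frac R` and non-zero `x₁, …, xₙ ∈ R` such that the centre `𝔪_O ∩ R` is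
generated by the `xᵢ`, the values `v(xᵢ)` are `ℤ`-independent, and `x` is a transcendence basis
of `K/k`.

Proof. (1) Knaf–Kuhlmann 2005, Thm. 3.4 in Hensel-root form (PROVED in the tree,
`KnafKuhlmann2005_Thm34_henselRoot_holds`) along `M`: `M = E(η)` with `E = k(x, y)`, `x` of
`ℤ`-independent values, `y ∈ O` of algebraically independent residues, `η ∈ O` a root of a monic
`f` over `O ∩ E` with `v(f'(η)) = 1`. (2) `O` being zero-dimensional, there are no `y`'s.
(3) Perron (Knaf–Kuhlmann 2005, Thm. 4.1, `knafKuhlmann2005_thm41_field`) replaces `x` by Laurent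
monomials `x'` with `k(x') = k(x)`, `v(x'ⱼ) < 1`, and puts the coefficients of `f` in
`R₀ = k[x'][1/d]`, `v(d) = 1`; every element of `R₀` is a constant modulo `(x')`, which defines
`f̄ ∈ k[X]` with `f ≡ f̄` coefficientwise, so `f̄(η̄) = 0 ≠ f̄'(η̄)` for the residue `η̄` of `η`:
`f̄ = Φ Ψ`, `Φ` the minimal polynomial of `η̄` over `k`, `Ψ(η̄) ≠ 0`, `u Φ + w Ψ = 1`.
(4) The chart is `R := k[x', 1/d, η, 1/Ψ(η)]`: every element of `R` is `≡ g(η)` modulo `(x') R`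
for some `g ∈ k[X]` (`1/Ψ(η) ≡ w(η)`), and `Φ(η) = f̄(η)/Ψ(η) = (f̄ - f)(η)/Ψ(η) ∈ (x') R`, so the
centre is `(x') R` (`span_eq_centre`); `x'` is algebraically independent over `k` and `K` is
algebraic over `M`, `M` over `E = k(x')`, so `x'` is a transcendence basis of `K/k`.
-/

-- single-problem summit: the doubled namespace component `ResolutionOfSingularities` is forced
set_option linter.dupNamespace false

namespace Summit.ResolutionOfSingularities.ResolutionOfSingularities.Theorems.PfaffLine

open IsLocalRing Polynomial Literature.AlgebraicGeometry.Resolution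

/-! ### Small subalgebra lemmas -/

/-- `k₀[s] ⊆ T` for a subring `T` containing `s` and the image of `k₀`. [folklore] -/
theorem adjoin_le_of_mem {k₀ K : Type} [CommSemiring k₀] [Field K] [Algebra k₀ K] {σ : Type}
    [SetLike σ K] [SubringClass σ K] (T : σ) (hT : ∀ c : k₀, algebraMap k₀ K c ∈ T) {s : Set K}
    (hs : s ⊆ T) : ∀ z ∈ Algebra.adjoin k₀ s, z ∈ T := fun _ hz =>
  Algebra.adjoin_induction (fun _ ha => hs ha) hT (fun _ _ _ _ => add_mem) (fun _ _ _ _ => mul_mem)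
    hz

/-- `g(η) ∈ T` for a subring `T ∋ η` containing the image of `k`. [folklore] -/
theorem aeval_mem_of_algebraMap_mem {k K : Type} [Field k] [Field K] [Algebra k K] {σ : Type}
    [SetLike σ K] [SubringClass σ K] (T : σ) (hT : ∀ c : k, algebraMap k K c ∈ T) {η : K}
    (hη : η ∈ T) (g : k[X]) : aeval η g ∈ T := by
  rw [aeval_eq_sum_range]
  exact sum_mem fun i _ => by rw [Algebra.smul_def]; exact mul_mem (hT _) (pow_mem hη i)

/-- Algebraicity over `k̄(s)`, `k̄` the image of `k` in `K`, is algebraicity over `k(s)`.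
[folklore] -/
theorem isAlgebraic_adjoin_of_closure {k K : Type} [Field k] [Field K] [Algebra k K] {s : Set K}
    {z : K} (h : IsAlgebraic (Subfield.closure (((algebraMap k K).fieldRange : Set K) ∪ s)) z) :
    IsAlgebraic (IntermediateField.adjoin k s) z := by
  have hle : Subfield.closure (((algebraMap k K).fieldRange : Set K) ∪ s) ≤
      (IntermediateField.adjoin k s).toSubfield := by
    rw [RingHom.coe_fieldRange]
    exact le_rfl
  exact isAlgebraic_of_ringHom_comp_eq (Subfield.inclusion hle) (RingHom.ext fun _ => rfl) h

/-! ### The stub -/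

/-- **The base chart from a Hensel root** (stub S2 of line `pfaff-line-log-final-forms`). For an
intermediate field `M` of the finitely generated `K/k`, finitely generated, along which the
zero-dimensional `O ⊇ k` is an Abhyankar place with separably generated residue field
extension, and over which `K` is algebraic, there is a very good chart of `M`: a finitely
generated `R ⊆ O ∩ M` with `M ⊆ Frac R`, whose centre is generated by `x₁, …, xₙ ∈ R` with
`ℤ`-independent values, `x` a transcendence basis of `K/k` (Knaf–Kuhlmann 2005, Thm. 3.4 in
Hensel-root form and Thm. 4.1, both PROVED in the tree; module docstring).
[cite: KnafKuhlmann2005, Thm. 3.4 and Thm. 4.1] -/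
theorem stub_henselRootChart :
    ∀ p : ℕ, p.Prime → ∀ (k K : Type) [Field k] [CharP k p] [Field K] [Algebra k K] (O : ValuationSubring K), (∀ c : k, algebraMap k K c ∈ O) → (⊤ : IntermediateField k K).FG → (∀ x : K, x ∈ O → ∃ f : Polynomial k, f ≠ 0 ∧ Polynomial.aeval x f ∈ O.nonunits) → ∀ (M : IntermediateField k K), M.FG → Literature.AlgebraicGeometry.Resolution.IsAbhyankarPlace O (algebraMap k K).fieldRange M.toSubfield → Literature.AlgebraicGeometry.Resolution.SeparablyGeneratedOver (Literature.AlgebraicGeometry.Resolution.resField O (algebraMap k K).fieldRange) (Literature.AlgebraicGeometry.Resolution.resField O M.toSubfield) → (∀ z : K, IsAlgebraic M z) → ∃ (n : ℕ) (R : Subalgebra k K) (hRO : R.toSubring ≤ O.toSubring) (x : Fin n → K) (hx : ∀ i, x i ∈ R), R.FG ∧ R ≤ M.toSubalgebra ∧ ((M : Set K) ⊆ Subfield.closure (R : Set K)) ∧ (∀ i, x i ≠ 0) ∧ Ideal.span (Set.range fun i => (⟨x i, hx i⟩ : R.toSubring)) = Ideal.comap (Subring.inclusion hRO) (IsLocalRing.maximalIdeal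 O) ∧ (∀ m : Fin n → ℤ, (∏ i, O.valuation (x i) ^ (m i)) = 1 → m = 0) ∧ IsTranscendenceBasis k x := by
  intro p hp k K _ _ _ _ O hk hKfg hzd M hMfg hAbh hsep hKM
  classical
  -- the ground field `k̄ ⊆ K` and the subfield `F` underlying `M`
  set kK : Subfield K := (algebraMap k K).fieldRange with hkKdef
  set F : Subfield K := M.toSubfield with hFdef
  have hkKO : (kK : Set K) ⊆ O := by
    rintro _ ⟨c, rfl⟩
    exact hk c
  have hkKO' : ∀ c ∈ kK, c ∈ O := fun c hc => hkKO hc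
  have hkKF : kK ≤ F := by
    rintro _ ⟨c, rfl⟩
    exact M.algebraMap_mem c
  have hFG : FGOver kK F := by
    obtain ⟨s, hs⟩ := hMfg
    refine ⟨s, ?_⟩
    have h1 : (IntermediateField.adjoin k (s : Set K)).toSubfield =
        Subfield.closure (Set.range (algebraMap k K) ∪ (s : Set K)) := rfl
    rw [hkKdef, RingHom.coe_fieldRange, ← h1, hs]
  -- Step 1: Knaf–Kuhlmann 2005, Thm. 3.4 in Hensel-root form, along `F`
  obtain ⟨ρ, τ, x, y, hy, hxF, -, hxi, hri, η, hηO, f, hgen, hfmon, hcoef, hfη, hfder⟩ :=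
    KnafKuhlmann2005_Thm34_henselRoot_holds K O kK F hkKF hFG hkKO hAbh hsep
  letI : Algebra k O := algebraOfMem k O hk
  haveI : IsScalarTower k O K := isScalarTower_algebraOfMem k O hk
  -- Step 2: `O` is zero-dimensional, so there are no `y`'s
  have hτ : τ = 0 := by
    have hyk : AlgebraicIndependent k fun j => residue O ⟨y j, hy j⟩ := by
      obtain ⟨φ, -, -, hφ, -⟩ := exists_residue_ringHoms O kK (F := kK) le_rfl hkKO'
      let φ' : k →+* resField O kK := φ.comp (algebraMap k K).rangeRestrictField
      refine AlgebraicIndependent.of_ringHom_of_comp_eq φ' (RingHom.id (ResidueField O))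
        (by simpa using hri) φ'.injective ?_
      ext c
      change ((φ ((algebraMap k K).rangeRestrictField c) : ResidueField O)) =
        residue O ⟨algebraMap k K c, hk c⟩
      rw [hφ]
      rfl
    refine (Nat.eq_zero_or_pos τ).resolve_right fun h => ?_
    obtain ⟨g, hg0, hg⟩ := hzd (y ⟨0, h⟩) (hy ⟨0, h⟩)
    rw [ValuationSubring.mem_nonunits_iff, valuation_aeval_lt_one_iff O hk (hy ⟨0, h⟩)] at hg
    exact hyk.transcendental ⟨0, h⟩ ⟨g, hg0, hg⟩
  subst hτ
  -- the rational function field `E = k̄(x)` with `F = E(η)`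
  set E : Subfield K := Subfield.closure ((kK : Set K) ∪ (Set.range x ∪ Set.range y)) with hEdef
  have hEF : E ≤ F := le_trans (fun z hz => Subfield.subset_closure (Or.inl hz)) hgen.le
  have hηF : η ∈ F := hgen.le (Subfield.subset_closure (Or.inr rfl))
  -- Step 3: Perron (Knaf–Kuhlmann 2005, Thm. 4.1) on the coefficients of `f`
  have hx0 : ∀ i, x i ≠ 0 := fun i => (hxF i).2
  set Z : Finset K := (Finset.range (f.natDegree + 1)).image f.coeff with hZdef
  have hZ : ∀ z ∈ Z, z ∈ O ∧ z ∈ E := by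
    intro z hz
    obtain ⟨i, -, rfl⟩ := Finset.mem_image.mp hz
    exact hcoef i
  obtain ⟨x', hx'E, hxE', hxi', hind', hZrep⟩ :=
    knafKuhlmann2005_thm41_field O kK hkKO' x y hx0 hxi hy hri Z hZ
  have hx'0 : ∀ j, x' j ≠ 0 := fun j => (hx'E j).2.1
  have hvx' : ∀ j, O.valuation (x' j) < 1 := fun j => (hx'E j).2.2
  have hx'O : ∀ j, x' j ∈ O := fun j => (O.valuation_le_one_iff _).mp (hvx' j).le
  set A : Subalgebra kK K := Algebra.adjoin kK (Set.range x' ∪ Set.range y) with hAdef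
  have hAE : ∀ z ∈ A, z ∈ E :=
    adjoin_le_of_mem E (fun c => Subfield.subset_closure (Or.inl c.2)) (by
      rintro _ (⟨j, rfl⟩ | ⟨j, rfl⟩)
      · exact (hx'E j).1
      · exact Subfield.subset_closure (Or.inr (Or.inr ⟨j, rfl⟩)))
  -- `A = k̄[x']` inside the `k`-algebra `A' = k[x']`, whose elements are constants modulo `(x')`
  set A' : Subalgebra k K := Algebra.adjoin k (Set.range x') with hA'def
  have hAA' : ∀ z ∈ A, z ∈ A' :=
    adjoin_le_of_mem A' (fun c => by
      obtain ⟨c', hc'⟩ := c.2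
      rw [show algebraMap kK K c = (c : K) from rfl, ← hc']
      exact A'.algebraMap_mem c') (by
      rintro _ (⟨j, rfl⟩ | ⟨j, -⟩)
      · exact Algebra.subset_adjoin ⟨j, rfl⟩
      · exact j.elim0)
  have hA'O : ∀ z ∈ A', z ∈ O := adjoin_le_of_mem O hk (by rintro _ ⟨j, rfl⟩; exact hx'O j)
  have hA'const : ∀ z ∈ A', ∃ c : k, z - algebraMap k K c ∈
      {z | ∃ r : Fin ρ → K, (∀ i, r i ∈ A') ∧ z = ∑ i, r i * x' i} :=
    forall_exists_const fun s hs => by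
      obtain ⟨j, rfl⟩ := hs
      exact ⟨0, by rw [map_zero, sub_zero]; exact self_mem_sp _ j⟩
  -- the common denominator `d` of the coefficients of `f`, `v(d) = 1`, `d ≡ β ≠ 0`
  choose num hnum den hden hvden hzeq using hZrep
  set d : K := ∏ w ∈ Z.attach, den w w.2 with hddef
  have hdA : d ∈ A := prod_mem fun w _ => hden w w.2
  have hvd : O.valuation d = 1 := by
    rw [hddef, map_prod]
    exact Finset.prod_eq_one fun w _ => hvden w w.2
  have hd0 : d ≠ 0 := fun h0 => by
    rw [h0, map_zero] at hvd
    exact zero_ne_one hvd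
  have hdO : d⁻¹ ∈ O := (O.valuation_le_one_iff _).mp (by rw [map_inv₀, hvd, inv_one])
  have hdE : d⁻¹ ∈ E := inv_mem (hAE d hdA)
  obtain ⟨β, hβ⟩ := hA'const d (hAA' d hdA)
  have hβ0 : β ≠ 0 := by
    rintro rfl
    have h := valuation_lt_one_of_mem_sp O hA'O hvx' hβ
    rw [map_zero, sub_zero, hvd] at h
    exact lt_irrefl _ h
  have hβK : algebraMap k K β ≠ 0 := (_root_.map_ne_zero (algebraMap k K)).mpr hβ0
  -- `R₀ = k[x', 1/d]` contains the coefficients of `f`; its elements are constants mod `(x')`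
  set R₀ : Subalgebra k K := Algebra.adjoin k (Set.range x' ∪ {d⁻¹}) with hR₀def
  have hA'R₀ : A' ≤ R₀ := Algebra.adjoin_mono Set.subset_union_left
  have hAR₀ : ∀ z ∈ A, z ∈ R₀ := fun z hz => hA'R₀ (hAA' z hz)
  have hdR₀ : d⁻¹ ∈ R₀ := Algebra.subset_adjoin (Or.inr rfl)
  have hR₀O : ∀ z ∈ R₀, z ∈ O := adjoin_le_of_mem O hk (by
    rintro _ (⟨j, rfl⟩ | h)
    · exact hx'O j
    · rw [Set.mem_singleton_iff] at h
      rw [h]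
      exact hdO)
  have hR₀const : ∀ z ∈ R₀, ∃ c : k, z - algebraMap k K c ∈
      {z | ∃ r : Fin ρ → K, (∀ i, r i ∈ R₀) ∧ z = ∑ i, r i * x' i} := by
    refine forall_exists_const fun s hs => ?_
    rcases hs with ⟨j, rfl⟩ | hs
    · exact ⟨0, by rw [map_zero, sub_zero]; exact self_mem_sp _ j⟩
    · rw [Set.mem_singleton_iff] at hs
      rw [hs]
      refine ⟨β⁻¹, ?_⟩
      have e : d⁻¹ - algebraMap k K β⁻¹ =
          -((d - algebraMap k K β) * ((algebraMap k K β)⁻¹ * d⁻¹)) := by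
        rw [map_inv₀]
        field_simp
        ring
      rw [e]
      refine neg_mem_sp (mul_mem_sp_right (sp_mono (fun z hz => hA'R₀ hz) hβ)
        (mul_mem ?_ hdR₀))
      rw [← map_inv₀]
      exact R₀.algebraMap_mem _
  have hZR₀ : ∀ z ∈ Z, z ∈ R₀ := by
    intro z hz
    have hden0 : den z hz ≠ 0 := fun h0 => by simpa [h0] using hvden z hz
    have hsplit : d = den z hz * ∏ w ∈ Z.attach.erase ⟨z, hz⟩, den w w.2 :=
      (Finset.mul_prod_erase Z.attach (fun w : {w // w ∈ Z} => den w w.2)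
        (Finset.mem_attach _ ⟨z, hz⟩)).symm
    have hzden : z * den z hz = num z hz := (eq_div_iff hden0).mp (hzeq z hz)
    have hz' : z = num z hz * (∏ w ∈ Z.attach.erase ⟨z, hz⟩, den w w.2) * d⁻¹ := by
      rw [← hzden, mul_assoc z, ← hsplit, mul_assoc, mul_inv_cancel₀ hd0, mul_one]
    rw [hz']
    exact mul_mem (mul_mem (hAR₀ _ (hnum z hz)) (hAR₀ _ (prod_mem fun w _ => hden w w.2))) hdR₀
  have hcoefR₀ : ∀ i, f.coeff i ∈ R₀ := by
    intro i
    by_cases hi : i < f.natDegree + 1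
    · exact hZR₀ _ (Finset.mem_image.mpr ⟨i, Finset.mem_range.mpr hi, rfl⟩)
    · rw [coeff_eq_zero_of_natDegree_lt (by omega)]
      exact zero_mem _
  -- the polynomial `f̄ ∈ k[X]` of constant parts of the coefficients of `f`
  choose cf hcf using fun i => hR₀const (f.coeff i) (hcoefR₀ i)
  set fb : k[X] := ∑ i ∈ Finset.range (f.natDegree + 1), C (cf i) * X ^ i with hfbdef
  have hfbcoeff : ∀ i, fb.coeff i = if i < f.natDegree + 1 then cf i else 0 := by
    intro i
    rw [hfbdef, finsetSum_coeff]
    simp only [coeff_C_mul, coeff_X_pow, mul_ite, mul_one, mul_zero, Finset.sum_ite_eq,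
      Finset.mem_range]
  have hcongr : ∀ i, f.coeff i - algebraMap k K (fb.coeff i) ∈
      {z | ∃ r : Fin ρ → K, (∀ i, r i ∈ R₀) ∧ z = ∑ i, r i * x' i} := by
    intro i
    rw [hfbcoeff]
    split_ifs with hi
    · exact hcf i
    · rw [coeff_eq_zero_of_natDegree_lt (by omega), map_zero, sub_zero]
      exact zero_mem_sp _
  -- `f̄(η̄) = 0 ≠ f̄'(η̄)` for the residue `η̄` of `η`: `f̄ = Φ Ψ`, `Ψ(η̄) ≠ 0`, `Φ, Ψ` coprime
  have hcongrO : ∀ i, f.coeff i - algebraMap k K (fb.coeff i) ∈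
      {z | ∃ r : Fin ρ → K, (∀ i, r i ∈ O) ∧ z = ∑ i, r i * x' i} :=
    fun i => sp_mono hR₀O (hcongr i)
  have hfbη : O.valuation (aeval η fb) < 1 := by
    have h := eval_sub_aeval_mem_sp hηO hcongrO
    rw [hfη, zero_sub] at h
    have h' := valuation_lt_one_of_mem_sp O (fun _ h => h) hvx' h
    rwa [Valuation.map_neg] at h'
  have hfb'η : O.valuation (aeval η (derivative fb)) = 1 :=
    valuation_eq_one_of_sub_lt O (valuation_lt_one_of_mem_sp O (fun _ h => h) hvx'
      (eval_sub_aeval_mem_sp hηO (coeff_derivative_sub_mem_sp hcongrO))) hfder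
      (valuation_aeval_le_one O hk hηO _)
  rw [valuation_aeval_lt_one_iff O hk hηO] at hfbη
  rw [valuation_aeval_eq_one_iff O hk hηO] at hfb'η
  obtain ⟨-, Ψ, hΦΨ, hΨres, hcop⟩ := exists_cofactor_minpoly k _ _ _ hfbη hfb'η
  set Φ : k[X] := minpoly k (residue O ⟨η, hηO⟩) with hΦdef
  have hvΨ : O.valuation (aeval η Ψ) = 1 := (valuation_aeval_eq_one_iff O hk hηO Ψ).mpr hΨres
  have hΨ0 : aeval η Ψ ≠ 0 := fun h0 => by
    rw [h0, map_zero] at hvΨ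
    exact zero_ne_one hvΨ
  set w : K := (aeval η Ψ)⁻¹ with hwdef
  have hwO : w ∈ O := (O.valuation_le_one_iff _).mp (by rw [hwdef, map_inv₀, hvΨ, inv_one])
  have hwΨ : w * aeval η Ψ = 1 := by rw [hwdef, inv_mul_cancel₀ hΨ0]
  -- Step 4: the chart `R = k[x', 1/d, η, 1/Ψ(η)]`
  set R : Subalgebra k K := Algebra.adjoin k (Set.range x' ∪ {d⁻¹, η, w}) with hRdef
  have hR₀R : R₀ ≤ R :=
    Algebra.adjoin_mono (Set.union_subset_union_right _
      (Set.singleton_subset_iff.mpr (Set.mem_insert _ _)))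
  have hx'R : ∀ j, x' j ∈ R := fun j => Algebra.subset_adjoin (Or.inl ⟨j, rfl⟩)
  have hηR : η ∈ R := Algebra.subset_adjoin (Or.inr (Set.mem_insert_of_mem _ (Set.mem_insert _ _)))
  have hwR : w ∈ R :=
    Algebra.subset_adjoin (Or.inr (Set.mem_insert_of_mem _ (Set.mem_insert_of_mem _ rfl)))
  have hRO' : ∀ z ∈ R, z ∈ O := adjoin_le_of_mem O hk (by
    rintro _ (⟨j, rfl⟩ | h)
    · exact hx'O j
    · rcases h with rfl | rfl | rfl
      exacts [hdO, hηO, hwO])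
  have hRO : R.toSubring ≤ O.toSubring := fun z hz => hRO' z hz
  have hkF : ∀ c : k, algebraMap k K c ∈ F := fun c => hkKF ⟨c, rfl⟩
  have hRF : ∀ z ∈ R, z ∈ F := adjoin_le_of_mem F hkF (by
    rintro _ (⟨j, rfl⟩ | h)
    · exact hEF (hx'E j).1
    · rcases h with rfl | rfl | rfl
      exacts [hEF hdE, hηF, inv_mem (aeval_mem_of_algebraMap_mem F hkF hηF Ψ)])
  -- Step 5: the centre of `R` is `(x') R`
  have hcongrR : ∀ i, f.coeff i - algebraMap k K (fb.coeff i) ∈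
      {z | ∃ r : Fin ρ → K, (∀ i, r i ∈ R) ∧ z = ∑ i, r i * x' i} :=
    fun i => sp_mono (fun z hz => hR₀R hz) (hcongr i)
  have hfbR : aeval η fb ∈ {z | ∃ r : Fin ρ → K, (∀ i, r i ∈ R) ∧ z = ∑ i, r i * x' i} := by
    have h := eval_sub_aeval_mem_sp hηR hcongrR
    rw [hfη, zero_sub] at h
    simpa using neg_mem_sp h
  have hΦR : aeval η Φ ∈ {z | ∃ r : Fin ρ → K, (∀ i, r i ∈ R) ∧ z = ∑ i, r i * x' i} := by
    have e : aeval η Φ = aeval η fb * w := by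
      rw [hΦΨ, map_mul, mul_assoc, mul_comm (aeval η Ψ), hwΨ, mul_one]
    rw [e]
    exact mul_mem_sp_right hfbR hwR
  have hgenR : ∀ z ∈ R, ∃ g : k[X],
      z - aeval η g ∈ {z | ∃ r : Fin ρ → K, (∀ i, r i ∈ R) ∧ z = ∑ i, r i * x' i} := by
    refine forall_exists_poly hηR fun s hs => ?_
    rcases hs with ⟨j, rfl⟩ | hs
    · exact ⟨0, by rw [map_zero, sub_zero]; exact self_mem_sp _ j⟩
    · rcases hs with rfl | rfl | rfl
      · obtain ⟨c, hc⟩ := hR₀const d⁻¹ hdR₀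
        exact ⟨C c, by rw [aeval_C]; exact sp_mono (fun z hz => hR₀R hz) hc⟩
      · exact ⟨X, by rw [aeval_X, sub_self]; exact zero_mem_sp _⟩
      · obtain ⟨u, v, huv⟩ := hcop
        refine ⟨v, ?_⟩
        have h1 : aeval η u * aeval η Φ + aeval η v * aeval η Ψ = 1 := by
          rw [← map_mul, ← map_mul, ← map_add, huv, map_one]
        have e : w - aeval η v = w * aeval η u * aeval η Φ := by
          calc w - aeval η v
              = w * (aeval η u * aeval η Φ + aeval η v * aeval η Ψ) - aeval η v := by
                rw [h1, mul_one]
            _ = w * aeval η u * aeval η Φ + aeval η v * (w * aeval η Ψ) - aeval η v := by ring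
            _ = w * aeval η u * aeval η Φ := by rw [hwΨ, mul_one, add_sub_cancel_right]
        rw [e]
        exact mul_mem_sp_left (mul_mem hwR (aeval_mem_subalgebra R hηR u)) hΦR
  have hcentre : Ideal.span (Set.range fun i => (⟨x' i, hx'R i⟩ : R.toSubring)) =
      Ideal.comap (Subring.inclusion hRO) (maximalIdeal O) :=
    span_eq_centre O hk R hRO hx'R hvx' hηR hgenR hΦR
  -- Step 6: the remaining clauses
  have hRfg : R.FG :=
    Subalgebra.fg_def.mpr ⟨Set.range x' ∪ {d⁻¹, η, w},
      (Set.finite_range x').union (Set.toFinite _), rfl⟩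
  have hRM : R ≤ M.toSubalgebra := fun z hz => hRF z hz
  have hkR : (kK : Set K) ⊆ Subfield.closure (R : Set K) := by
    rintro _ ⟨c, rfl⟩
    exact Subfield.subset_closure (R.algebraMap_mem c)
  have hER : E ≤ Subfield.closure (R : Set K) := by
    rw [hEdef, Subfield.closure_le]
    refine Set.union_subset hkR (Set.union_subset ?_ ?_)
    · rintro _ ⟨i, rfl⟩
      refine (Subfield.closure_le.mpr (Set.union_subset hkR ?_)) (hxE' i)
      rintro _ ⟨j, rfl⟩
      exact Subfield.subset_closure (hx'R j)
    · rintro _ ⟨j, -⟩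
      exact j.elim0
  have hMR : (M : Set K) ⊆ Subfield.closure (R : Set K) := by
    intro z hz
    refine (Subfield.closure_le.mpr (Set.union_subset hER ?_)) (hgen.ge (show z ∈ F from hz))
    exact Set.singleton_subset_iff.mpr (Subfield.subset_closure (hηR))
  have hvalind : ∀ m : Fin ρ → ℤ, (∏ i, O.valuation (x' i) ^ (m i)) = 1 → m = 0 :=
    fun m hm => hxi' m ⟨1, kK.one_mem, by rw [hm, map_one]⟩
  -- `x'` is a transcendence basis of `K/k`
  have hind : AlgebraicIndependent k x' := by
    have h1 : AlgebraicIndependent kK x' := by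
      simpa using hind'.comp Sum.inl Sum.inl_injective
    exact AlgebraicIndependent.of_ringHom_of_comp_eq (algebraMap k K).rangeRestrictField
      (RingHom.id K) (by simpa using h1) (algebraMap k K).rangeRestrictField.injective
      (RingHom.ext fun _ => rfl)
  have hE' : E ≤ Subfield.closure ((kK : Set K) ∪ Set.range x') := by
    rw [hEdef, Subfield.closure_le]
    refine Set.union_subset (fun z hz => Subfield.subset_closure (Or.inl hz))
      (Set.union_subset ?_ ?_)
    · rintro _ ⟨i, rfl⟩
      exact hxE' i
    · rintro _ ⟨j, -⟩
      exact j.elim0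
  have hηalg : IsAlgebraic E η := by
    have hl : f ∈ Polynomial.lifts (algebraMap E K) :=
      (Polynomial.lifts_iff_coeff_lifts f).mpr fun i => ⟨⟨f.coeff i, (hcoef i).2⟩, rfl⟩
    obtain ⟨fE, hfE, -, hfEmon⟩ := Polynomial.lifts_and_degree_eq_and_monic hl hfmon
    refine ⟨fE, hfEmon.ne_zero, ?_⟩
    rw [aeval_def, ← eval_map, hfE, hfη]
  have hFalg : ∀ z ∈ F, IsAlgebraic E z := by
    intro z hz
    refine isAlgebraic_of_mem_closure (K := E) (s := {η}) (fun a ha => ?_) (hgen.ge hz)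
    rw [Set.mem_singleton_iff] at ha
    rw [ha]
    exact hηalg
  have hKalg : ∀ z : K, IsAlgebraic (IntermediateField.adjoin k (Set.range x')) z := by
    intro z
    have h1 : IsAlgebraic F z :=
      isAlgebraic_of_ringHom_comp_eq (F₁ := M) (F₂ := F)
        { toFun := fun m => ⟨m.1, m.2⟩
          map_one' := rfl
          map_mul' := fun _ _ => rfl
          map_zero' := rfl
          map_add' := fun _ _ => rfl } (RingHom.ext fun _ => rfl) (hKM z)
    exact isAlgebraic_adjoin_of_closure
      (isAlgebraic_of_subfield_le hE' (isAlgebraic_trans_subfield hEF hFalg h1))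
  have hTB : IsTranscendenceBasis k x' :=
    hind.isTranscendenceBasis_iff_isAlgebraic.mpr
      (IntermediateField.isAlgebraic_adjoin_iff_top.mp ⟨hKalg⟩)
  exact ⟨ρ, R, hRO, x', hx'R, hRfg, hRM, hMR, hx'0, hcentre, hvalind, hTB⟩

end Summit.ResolutionOfSingularities.ResolutionOfSingularities.Theorems.PfaffLine
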